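import Mathlib
import Summits.PneNP.PneNP.Theorems.CnfIdealGenLengthRankDefectRepresentationsQuadrantCapture

/-!
# Crux `RankDefectRepresentations` (stmt-PneNP-18923), line `rank-dehn-ladder`: PROFILE FLIP-STABILITY (registered tool stub W8
# `stub_profileFlip`, lead g15 RESHAPE 11; briefs `Cruxes/RankDefectRepresentations/Lines/rank-dehn-ladder-briefs-g15c.md` §W8,
# memo `Cruxes/RankDefectRepresentations/Lines/rank-dehn-ladder-g15.md` §7b)

For a two-family instance `D` (rows and columns coloured by `{0,1}^n × {0,1}^{n'}`; `doubleCut row col B B' D` is the double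
bipartition cut at the first-family set `B` and the second-family set `B'`), the PROFILE `B ↦ doubleCut row col B B' D` (`B'` fixed)
is an approximate length function on first-family sets: flipping `B` by `B₁` moves it by at most four times the profile of `B₁`,

  `doubleCut (B ∆ B₁) B' D ≤ doubleCut B B' D + 4 · doubleCut B₁ B' D`   (`doubleCut_symmDiff_le`, and the reverse direction
  `doubleCut_le_symmDiff_add`),

whence the registered statement `stub_profileFlip` (hypothesis `doubleCut B₁ B'' D ≤ δ` for all `B''`, used only at `B'' = B'`;
the registered constant `16` exceeds the `4` proved here).  This generalises the exact symmetry `doubleCut_eq_of_noCross` of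
`…HalvesDiscount` (the case `δ = 0`).

Proof.  `M := maskJ row col B' D` is fixed throughout; for a row predicate `p` and a column predicate `q` write `N[p × q]` for the
zero-padded block `Matrix.of fun x y => if p x ∧ q y then N x y else 0`.  Reading rows and columns through their first-family
colour, `doubleCut B B' D = rank M[B × Bᶜ] + rank M[Bᶜ × B]` (definition) and `doubleCut B₁ B' D = rank C + rank C'` with
`C := M[B₁ × B₁ᶜ]`, `C' := M[B₁ᶜ × B₁]`.  Split a block `N` into its four sub-blocks along (`B₁` on rows, `B₁` on columns):
`rank N ≤ Σ` (four ranks) (`rank_le_sum_four`), and the two DIAGONAL sub-blocks lie in disjoint rows and disjoint columns, so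
`rank N[B₁ × B₁] + rank N[B₁ᶜ × B₁ᶜ] ≤ rank N + rank N[B₁ × B₁ᶜ] + rank N[B₁ᶜ × B₁]` (`rank_diag_blocks_le`, from
`…QuadrantCapture.rank_add_of_disjoint` and `rank_sub_le'`).  For `N` one of the four rectangles `M[B × Bᶜ]`, `M[Bᶜ × B]`,
`M[(B∆B₁) × (B∆B₁)ᶜ]`, `M[(B∆B₁)ᶜ × (B∆B₁)]` the two OFF-diagonal sub-blocks are blocks of `C` and of `C'` (`rank_mask_block_le`),
and the diagonal sub-blocks of the two NEW rectangles are literally the diagonal sub-blocks of the two OLD ones (`block_congr`; these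
are the four "main" blocks `Z × X₂`, `X₁ × Y`, `X₂ × Z`, `Y × X₁` of the brief, `Z = B ∩ B₁`, `X₁ = B ∖ B₁`, `X₂ = B₁ ∖ B`,
`Y = (B ∪ B₁)ᶜ`).  Adding up (`flip_le`): new `≤ mains + 2 (rank C + rank C')` and `mains ≤ old + 2 (rank C + rank C')`.
HONEST FRAMING: elementary linear algebra (block-rank bookkeeping), a tool for the MERGE step of the line; `stub_merge` and the crux
stay open; P ≠ NP is not moved; F-N2 is a FRONTIER formal rung.
-/

set_option linter.dupNamespace false -- `Summit.PneNP.PneNP.…`: summit = sub-problem name (D-0017)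

namespace Summit.PneNP.PneNP.Theorems.CnfIdealGenLengthRankDefectRepresentationsProfileFlip

open Summit.PneNP.PneNP.Theorems.CnfIdealGenLengthRankDefectRepresentationsTwoFamilyCutDomination (colourI maskJ doubleCut)
open Summit.PneNP.PneNP.Theorems.CnfIdealGenLengthRankDefectRepresentationsQuadrantCapture (rank_add_of_disjoint)
open Summit.PneNP.PneNP.Theorems.CnfIdealGenLengthRankDefectRepresentationsMergeLowerBound (rank_add_le' rank_sub_le')
open Summit.PneNP.PneNP.Theorems.CnfIdealGenLengthRankDefectRepresentationsStripCompletion (rank_mask_le)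

variable {K : Type} [Field K]

/-! ## Symmetric difference as "exactly one" -/

/-- Membership in a symmetric difference of finsets: `p ∈ B ∆ B₁ ↔ ¬ (p ∈ B ↔ p ∈ B₁)`. [folklore] -/
theorem mem_symmDiff_iff_not_iff {α : Type} [DecidableEq α] (B B₁ : Finset α) (p : α) :
    p ∈ symmDiff B B₁ ↔ ¬ (p ∈ B ↔ p ∈ B₁) := by
  rw [Finset.mem_symmDiff]
  tauto

/-- From `S ↔ ¬(P ↔ P₁)`: if `P₁` holds then `S ↔ ¬P`. [folklore] -/
theorem iff_not_of_iff_not_iff {P P₁ S : Prop} (h : S ↔ ¬ (P ↔ P₁)) (h₁ : P₁) : S ↔ ¬ P := by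
  rw [h, iff_true_right h₁]

/-- From `S ↔ ¬(P ↔ P₁)`: if `P₁` fails then `S ↔ P`. [folklore] -/
theorem iff_of_iff_not_iff {P P₁ S : Prop} (h : S ↔ ¬ (P ↔ P₁)) (h₁ : ¬ P₁) : S ↔ P := by
  rw [h, iff_false_right h₁, not_not]

/-! ## Four-block bookkeeping for zero-padded blocks `N[p × q] := Matrix.of fun x y => if p x ∧ q y then N x y else 0` -/

section Blocks

variable {ι ι' : Type} [Fintype ι] [Fintype ι'] [DecidableEq ι] [DecidableEq ι']
variable (p : ι → Prop) (q : ι' → Prop) [DecidablePred p] [DecidablePred q]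

omit [Fintype ι] [Fintype ι'] [DecidableEq ι] [DecidableEq ι'] in
/-- A matrix is the sum of its four blocks along a row predicate `p` and a column predicate `q`. [folklore] -/
theorem eq_sum_four_blocks (N : Matrix ι ι' K) :
    N = (Matrix.of fun x y => if p x ∧ q y then N x y else 0) + (Matrix.of fun x y => if p x ∧ ¬ q y then N x y else 0) +
      (Matrix.of fun x y => if ¬ p x ∧ q y then N x y else 0) + (Matrix.of fun x y => if ¬ p x ∧ ¬ q y then N x y else 0) := by
  ext x y
  simp only [Matrix.add_apply, Matrix.of_apply]
  by_cases h1 : p x <;> by_cases h2 : q y <;> simp [h1, h2]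

omit [DecidableEq ι] [DecidableEq ι'] in
/-- **Upper bound.**  The rank of a matrix is at most the sum of the ranks of its four blocks. [folklore] -/
theorem rank_le_sum_four (N : Matrix ι ι' K) :
    N.rank ≤ (Matrix.of fun x y => if p x ∧ q y then N x y else 0).rank +
      (Matrix.of fun x y => if p x ∧ ¬ q y then N x y else 0).rank +
      (Matrix.of fun x y => if ¬ p x ∧ q y then N x y else 0).rank +
      (Matrix.of fun x y => if ¬ p x ∧ ¬ q y then N x y else 0).rank := by
  conv_lhs => rw [eq_sum_four_blocks p q N]
  exact (rank_add_le' _ _).trans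
    (Nat.add_le_add_right ((rank_add_le' _ _).trans (Nat.add_le_add_right (rank_add_le' _ _) _)) _)

/-- **Lower bound.**  The two diagonal blocks lie in disjoint rows and disjoint columns, so their ranks add
(`rank_add_of_disjoint`), and their sum is `N` minus the two off-diagonal blocks:
`rank N[p × q] + rank N[pᶜ × qᶜ] ≤ rank N + rank N[p × qᶜ] + rank N[pᶜ × q]`. [folklore] -/
theorem rank_diag_blocks_le (N : Matrix ι ι' K) :
    (Matrix.of fun x y => if p x ∧ q y then N x y else 0).rank +
        (Matrix.of fun x y => if ¬ p x ∧ ¬ q y then N x y else 0).rank ≤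
      N.rank + (Matrix.of fun x y => if p x ∧ ¬ q y then N x y else 0).rank +
        (Matrix.of fun x y => if ¬ p x ∧ q y then N x y else 0).rank := by
  have hadd := rank_add_of_disjoint p q (Matrix.of fun x y => if p x ∧ q y then N x y else 0)
    (Matrix.of fun x y => if ¬ p x ∧ ¬ q y then N x y else 0)
    (fun x y h => by rw [Matrix.of_apply, if_neg h]) (fun x y h => by rw [Matrix.of_apply, if_neg h])
  rw [← hadd]
  have e : (Matrix.of fun x y => if p x ∧ q y then N x y else 0) + (Matrix.of fun x y => if ¬ p x ∧ ¬ q y then N x y else 0) =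
      N - (Matrix.of fun x y => if p x ∧ ¬ q y then N x y else 0) - (Matrix.of fun x y => if ¬ p x ∧ q y then N x y else 0) := by
    ext x y
    simp only [Matrix.add_apply, Matrix.sub_apply, Matrix.of_apply]
    by_cases h1 : p x <;> by_cases h2 : q y <;> simp [h1, h2]
  rw [e]
  exact (rank_sub_le' _ _).trans (Nat.add_le_add_right (rank_sub_le' _ _) _)

/-- **Sub-blocks.**  The `p × q` block of any block `N[p' × q']` is a block of `N[p × q]`, so its rank is at most `rank N[p × q]`
(`rank_mask_le`: masking is a sandwich between diagonal matrices). [folklore] -/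
theorem rank_mask_block_le (p' : ι → Prop) (q' : ι' → Prop) [DecidablePred p'] [DecidablePred q'] (N : Matrix ι ι' K) :
    (Matrix.of fun x y => if p x ∧ q y then (Matrix.of fun x y => if p' x ∧ q' y then N x y else (0 : K)) x y else 0).rank ≤
      (Matrix.of fun x y => if p x ∧ q y then N x y else 0).rank := by
  have e : (Matrix.of fun x y => if p x ∧ q y then (Matrix.of fun x y => if p' x ∧ q' y then N x y else (0 : K)) x y else 0) =
      Matrix.of fun x y => if p' x ∧ q' y then (Matrix.of fun x y => if p x ∧ q y then N x y else (0 : K)) x y else 0 := by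
    ext x y
    simp only [Matrix.of_apply]
    split_ifs <;> rfl
  rw [e]
  exact rank_mask_le p' q' _

omit [Fintype ι] [Fintype ι'] [DecidableEq ι] [DecidableEq ι'] in
/-- **Same block.**  If two cell predicates `c`, `c'` agree on `p × q`, the `p × q` blocks of `N[c]` and `N[c']` coincide. [folklore] -/
theorem block_congr (c c' : ι → ι' → Prop) [∀ x y, Decidable (c x y)] [∀ x y, Decidable (c' x y)] (N : Matrix ι ι' K)
    (h : ∀ x y, p x → q y → (c x y ↔ c' x y)) :
    (Matrix.of fun x y => if p x ∧ q y then (Matrix.of fun x y => if c x y then N x y else (0 : K)) x y else 0) =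
      Matrix.of fun x y => if p x ∧ q y then (Matrix.of fun x y => if c' x y then N x y else (0 : K)) x y else 0 := by
  ext x y
  simp only [Matrix.of_apply]
  by_cases hpq : p x ∧ q y
  · rw [if_pos hpq, if_pos hpq]
    by_cases hc : c x y
    · rw [if_pos hc, if_pos ((h x y hpq.1 hpq.2).1 hc)]
    · rw [if_neg hc, if_neg (fun hc' => hc ((h x y hpq.1 hpq.2).2 hc'))]
  · rw [if_neg hpq, if_neg hpq]

/-- **Master inequality** (the profile flip in abstract form).  Row predicates `a, a₁, s` and column predicates `b, b₁, t` with
`s ↔ ¬(a ↔ a₁)` and `t ↔ ¬(b ↔ b₁)` (in the application: membership of the first-family colour in `B`, `B₁`, `B ∆ B₁`); then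
`rank M[s × tᶜ] + rank M[sᶜ × t] ≤ (rank M[a × bᶜ] + rank M[aᶜ × b]) + 4 · (rank M[a₁ × b₁ᶜ] + rank M[a₁ᶜ × b₁])`.
Every one of the four rectangles is split into four blocks along `(a₁, b₁)`: off-diagonal blocks are blocks of `M[a₁ × b₁ᶜ]`,
`M[a₁ᶜ × b₁]`; the diagonal blocks of the `s/t` rectangles are the diagonal blocks of the `a/b` rectangles. -/
theorem flip_le (a a₁ s : ι → Prop) (b b₁ t : ι' → Prop) [DecidablePred a] [DecidablePred a₁] [DecidablePred s]
    [DecidablePred b] [DecidablePred b₁] [DecidablePred t] (hs : ∀ x, s x ↔ ¬ (a x ↔ a₁ x)) (ht : ∀ y, t y ↔ ¬ (b y ↔ b₁ y))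
    (M : Matrix ι ι' K) :
    (Matrix.of fun x y => if s x ∧ ¬ t y then M x y else 0).rank + (Matrix.of fun x y => if ¬ s x ∧ t y then M x y else 0).rank ≤
      ((Matrix.of fun x y => if a x ∧ ¬ b y then M x y else 0).rank + (Matrix.of fun x y => if ¬ a x ∧ b y then M x y else 0).rank) +
      4 * ((Matrix.of fun x y => if a₁ x ∧ ¬ b₁ y then M x y else 0).rank +
        (Matrix.of fun x y => if ¬ a₁ x ∧ b₁ y then M x y else 0).rank) := by
  -- the six blocks: old rectangles `A, A'`, the flip's rectangles `C, C'`, new rectangles `R, R'`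
  set A : Matrix ι ι' K := Matrix.of fun x y => if a x ∧ ¬ b y then M x y else 0 with hA
  set A' : Matrix ι ι' K := Matrix.of fun x y => if ¬ a x ∧ b y then M x y else 0 with hA'
  set C : Matrix ι ι' K := Matrix.of fun x y => if a₁ x ∧ ¬ b₁ y then M x y else 0 with hC
  set C' : Matrix ι ι' K := Matrix.of fun x y => if ¬ a₁ x ∧ b₁ y then M x y else 0 with hC'
  set R : Matrix ι ι' K := Matrix.of fun x y => if s x ∧ ¬ t y then M x y else 0 with hR
  set R' : Matrix ι ι' K := Matrix.of fun x y => if ¬ s x ∧ t y then M x y else 0 with hR'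
  -- four-block splits along `(a₁, b₁)`: upper bounds for the new rectangles, lower bounds for the old ones
  have hR4 := rank_le_sum_four a₁ b₁ R
  have hR'4 := rank_le_sum_four a₁ b₁ R'
  have hA4 := rank_diag_blocks_le a₁ b₁ A
  have hA'4 := rank_diag_blocks_le a₁ b₁ A'
  -- the eight off-diagonal blocks are blocks of `C` or of `C'`
  have e1 : (Matrix.of fun x y => if a₁ x ∧ ¬ b₁ y then R x y else 0).rank ≤ C.rank := by
    rw [hR, hC]; exact rank_mask_block_le a₁ (fun y => ¬ b₁ y) s (fun y => ¬ t y) M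
  have e2 : (Matrix.of fun x y => if ¬ a₁ x ∧ b₁ y then R x y else 0).rank ≤ C'.rank := by
    rw [hR, hC']; exact rank_mask_block_le (fun x => ¬ a₁ x) b₁ s (fun y => ¬ t y) M
  have e3 : (Matrix.of fun x y => if a₁ x ∧ ¬ b₁ y then R' x y else 0).rank ≤ C.rank := by
    rw [hR', hC]; exact rank_mask_block_le a₁ (fun y => ¬ b₁ y) (fun x => ¬ s x) t M
  have e4 : (Matrix.of fun x y => if ¬ a₁ x ∧ b₁ y then R' x y else 0).rank ≤ C'.rank := by
    rw [hR', hC']; exact rank_mask_block_le (fun x => ¬ a₁ x) b₁ (fun x => ¬ s x) t M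
  have e5 : (Matrix.of fun x y => if a₁ x ∧ ¬ b₁ y then A x y else 0).rank ≤ C.rank := by
    rw [hA, hC]; exact rank_mask_block_le a₁ (fun y => ¬ b₁ y) a (fun y => ¬ b y) M
  have e6 : (Matrix.of fun x y => if ¬ a₁ x ∧ b₁ y then A x y else 0).rank ≤ C'.rank := by
    rw [hA, hC']; exact rank_mask_block_le (fun x => ¬ a₁ x) b₁ a (fun y => ¬ b y) M
  have e7 : (Matrix.of fun x y => if a₁ x ∧ ¬ b₁ y then A' x y else 0).rank ≤ C.rank := by
    rw [hA', hC]; exact rank_mask_block_le a₁ (fun y => ¬ b₁ y) (fun x => ¬ a x) b M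
  have e8 : (Matrix.of fun x y => if ¬ a₁ x ∧ b₁ y then A' x y else 0).rank ≤ C'.rank := by
    rw [hA', hC']; exact rank_mask_block_le (fun x => ¬ a₁ x) b₁ (fun x => ¬ a x) b M
  -- the four main blocks: diagonal blocks of the new rectangles = diagonal blocks of the old ones
  have m1 : (Matrix.of fun x y => if a₁ x ∧ b₁ y then R x y else 0).rank =
      (Matrix.of fun x y => if a₁ x ∧ b₁ y then A' x y else 0).rank := by
    rw [hR, hA']
    exact congrArg Matrix.rank (block_congr a₁ b₁ (fun x y => s x ∧ ¬ t y) (fun x y => ¬ a x ∧ b y) M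
      (fun x y hx hy => by rw [iff_not_of_iff_not_iff (hs x) hx, iff_not_of_iff_not_iff (ht y) hy, not_not]))
  have m2 : (Matrix.of fun x y => if ¬ a₁ x ∧ ¬ b₁ y then R x y else 0).rank =
      (Matrix.of fun x y => if ¬ a₁ x ∧ ¬ b₁ y then A x y else 0).rank := by
    rw [hR, hA]
    exact congrArg Matrix.rank (block_congr (fun x => ¬ a₁ x) (fun y => ¬ b₁ y) (fun x y => s x ∧ ¬ t y)
      (fun x y => a x ∧ ¬ b y) M
      (fun x y hx hy => by rw [iff_of_iff_not_iff (hs x) hx, iff_of_iff_not_iff (ht y) hy]))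
  have m3 : (Matrix.of fun x y => if a₁ x ∧ b₁ y then R' x y else 0).rank =
      (Matrix.of fun x y => if a₁ x ∧ b₁ y then A x y else 0).rank := by
    rw [hR', hA]
    exact congrArg Matrix.rank (block_congr a₁ b₁ (fun x y => ¬ s x ∧ t y) (fun x y => a x ∧ ¬ b y) M
      (fun x y hx hy => by rw [iff_not_of_iff_not_iff (hs x) hx, iff_not_of_iff_not_iff (ht y) hy, not_not]))
  have m4 : (Matrix.of fun x y => if ¬ a₁ x ∧ ¬ b₁ y then R' x y else 0).rank =
      (Matrix.of fun x y => if ¬ a₁ x ∧ ¬ b₁ y then A' x y else 0).rank := by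
    rw [hR', hA']
    exact congrArg Matrix.rank (block_congr (fun x => ¬ a₁ x) (fun y => ¬ b₁ y) (fun x y => ¬ s x ∧ t y)
      (fun x y => ¬ a x ∧ b y) M
      (fun x y hx hy => by rw [iff_of_iff_not_iff (hs x) hx, iff_of_iff_not_iff (ht y) hy]))
  omega

end Blocks

/-! ## The profile flip for double cuts -/

section TwoFamily

variable {n n' : ℕ} {ι ι' : Type} [Fintype ι] [Fintype ι'] [DecidableEq ι] [DecidableEq ι']
variable (row : ι → Fin n ⊕ Fin n' → Bool) (col : ι' → Fin n ⊕ Fin n' → Bool)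

/-- **PROFILE FLIP-STABILITY (sharp form).**  For every two-family instance `D`, first-family sets `B, B₁` and second-family set `B'`:
`doubleCut (B ∆ B₁) B' D ≤ doubleCut B B' D + 4 · doubleCut B₁ B' D`. -/
theorem doubleCut_symmDiff_le (B B₁ : Finset (Fin n → Bool)) (B' : Finset (Fin n' → Bool)) (D : Matrix ι ι' K) :
    doubleCut row col (symmDiff B B₁) B' D ≤ doubleCut row col B B' D + 4 * doubleCut row col B₁ B' D := by
  unfold doubleCut
  exact flip_le (fun x => colourI (row x) ∈ B) (fun x => colourI (row x) ∈ B₁) (fun x => colourI (row x) ∈ symmDiff B B₁)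
    (fun y => colourI (col y) ∈ B) (fun y => colourI (col y) ∈ B₁) (fun y => colourI (col y) ∈ symmDiff B B₁)
    (fun x => mem_symmDiff_iff_not_iff B B₁ (colourI (row x))) (fun y => mem_symmDiff_iff_not_iff B B₁ (colourI (col y)))
    (maskJ row col B' D)

/-- **The profile is an approximate length function**: the reverse direction `doubleCut B B' D ≤ doubleCut (B ∆ B₁) B' D + 4 · doubleCut B₁ B' D`
(apply the flip to `B ∆ B₁`, since `(B ∆ B₁) ∆ B₁ = B`). -/
theorem doubleCut_le_symmDiff_add (B B₁ : Finset (Fin n → Bool)) (B' : Finset (Fin n' → Bool)) (D : Matrix ι ι' K) :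
    doubleCut row col B B' D ≤ doubleCut row col (symmDiff B B₁) B' D + 4 * doubleCut row col B₁ B' D := by
  have h := doubleCut_symmDiff_le row col (symmDiff B B₁) B₁ B' D
  rwa [symmDiff_symmDiff_cancel_right] at h

end TwoFamily

/-! ## The registered stub -/

/-- **PROFILE FLIP-STABILITY** (registered stub `stub_profileFlip` of `Cruxes/RankDefectRepresentations/Lines/rank_dehn_ladder.lean`, lead g15
RESHAPE 11, W8): if every double cut at the first-family set `B₁` is `≤ δ`, then flipping `B` by `B₁` raises the double cut at `(B, B')` by at
most `16 δ` (in fact by at most `4 · doubleCut B₁ B' D ≤ 4 δ`, `doubleCut_symmDiff_le`). -/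
theorem stub_profileFlip :
    ∀ (K : Type) [Field K] (n n' : ℕ) (ι ι' : Type) [Fintype ι] [Fintype ι'] [DecidableEq ι] [DecidableEq ι']
      (row : ι → Fin n ⊕ Fin n' → Bool) (col : ι' → Fin n ⊕ Fin n' → Bool) (D : Matrix ι ι' K) (δ : ℕ)
      (B B₁ : Finset (Fin n → Bool)) (B' : Finset (Fin n' → Bool)),
      (∀ B'', Summit.PneNP.PneNP.Theorems.CnfIdealGenLengthRankDefectRepresentationsTwoFamilyCutDomination.doubleCut row col B₁ B'' D ≤ δ) →
      Summit.PneNP.PneNP.Theorems.CnfIdealGenLengthRankDefectRepresentationsTwoFamilyCutDomination.doubleCut row col (symmDiff B B₁) B' D ≤ Summit.PneNP.PneNP.Theorems.CnfIdealGenLengthRankDefectRepresentationsTwoFamilyCutDomination.doubleCut row col B B' D + 16 * δ := by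
  intro K _ n n' ι ι' _ _ _ _ row col D δ B B₁ B' hδ
  have h := doubleCut_symmDiff_le row col B B₁ B' D
  have h1 := hδ B'
  omega

end Summit.PneNP.PneNP.Theorems.CnfIdealGenLengthRankDefectRepresentationsProfileFlip
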